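import Summits.QuantumFields.YangMills.Theorems.BalabanUVNodesK2NamedJetsRunRemAt

/-!
# F4 (idea-4 g5) — the LAST HISTORY SLOT of the record's β is the GAUGE-FIXING COEFFICIENT of the last step:
# L¹ᵤ(run) (`RunsGivenB4.RunLastVarDerivBound`, card `runs-given-b` ed. 4's residual K1) is MIS-AIMED and is WITHDRAWN

Crux of record: `stmt-QuantumFields-20543` = `Summit.QuantumFields.YangMills.Theses.BalabanUVNodes.EndpointGivenBR13SepCoPH` (route
`route-QuantumFields-BalabanUVNodes`, skeleton v6 LINE 1′ RUN EDITION `stub_runRemNamedJets13 : RunRemAtSomeJets`).  Companion of the workfile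
`F4-LASTSLOT-idea4g5.md` and of card `Ideas/runs-given-b.md` EDITION 5.  Executes CRIT-1 g4's endorsed falsifier F4(i) («does g_k enter β_merged only
through maps smooth on ]0,γ] …; else K1 FALSE as typed at the record») as a LOCATED READ of the tree — on top of BN-F (idea-5 g3,
`BN-F-GaugeSlotIR-idea5g3.md` + `GaugeSlotIRProbe.lean`, CREDITED for the located typing fact §1 and (N1)–(N2)).

§1  WHICH SLOTS `A_k` READS (kernel congruence, generic over the printed recursion (0.17)∕(0.19)): `A_k = printedSeq … g w k` is a function of
    `g 0, …, g (k−1)` only (`printedSeq_congr_below`), and slot `k` enters `A_{k+1}` — hence the merged term `𝓝_{k+1} = A_{k+1} − A_k∘(Ū∘U_k)`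
    and `β_merged k` — ONLY as `nextAction`'s parameter `gk`, i.e. as the coefficient `1/g_k²` of the soft axial gauge fixing `GF_k` INSIDE the
    blocks of step `k` (`integrand χ GF gk A U = χ U · exp(−GF U / gk² + A U)`, [Balaban1987RG1] (0.19) p. 255) — NOT as the coupling of `A_k`
    (`printedSeq_succ_sub_of_agree_below`, `mergedTermT_sub_of_agree_below`).  Print's variable «g_k» of «β_{k+1}(g_k) smooth on [0, γ]» (p. 264) and
    of «(2.13) vanishes at g_k = 0» (p. 268) is the MAIN coupling of the (1.6)-parametrised action; the record instantiates no such parameter off the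
    runs of (0.20) (on runs the two coincide: `Node00.sum_beta_eq_of_rgEqH`).
§2  WHAT THE CLOSED END OF L¹ᵤ(run) READS: along every in-window run, differentiability WITHIN `[0, γ₀]` at `g = 0` forces the right-limit of the
    GF-slot section `t ↦ β_{k+1}(g_0,…,g_{k−1}, t)` to be the record's value AT `t = 0`, which is the value at the ZERO HISTORY (off-box indicator
    convention of `Node00.betaOfMerged`) = `beta0OfMerged βm θ.v₀ k` = the sharp-gauge β of the flow from the BASE's bare coupling (BN-F (N1); the
    zero action at the tree's `v₀ = 0`) — for EVERY bare coupling `g_0` of an in-window run: BN-F (N2)'s rigidity is built into the letter's closed end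
    (`tendsto_gfSlot_of_runLastVarDerivBound`, `tendsto_gfSlot_zeroHistory_of_runLastVarDerivBound`); two base conventions sharing the merged β and
    one in-window run refute it (`runLastVarDerivBound_false_of_twoBases`, the `_false_without_` shape of `Negative/Anchor13FalseOfTwoBaseHistories`).
§3  THE REDIRECT (no new letter): the honest run-format residual is a MODULUS ∕ RATE IN THE RUNNING COUPLING read AT the in-window run prefixes —
    idea-5 ed. 2.3's `RunModRemainder` (`ConvexFibreWittenSketch3.lean` :79, `k ≤ n`; ⟹ the registered conjunct `RunConstRemainder … r γ₁` for every
    `r > 0` on a sub-level, :90) ∕ ed. 2.2's `ModOnRuns`.  No derivative, no last variable, no closed end — and nothing evaluated off a run.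

HONEST FRAMING: elementary bookkeeping (structural recursion, one-sided limits); NOTHING of Bałaban's analysis is proved or its price lowered; K2⁷ is
NOT proved; NODE O = [Balaban1987RG1] Thm 2 ∕ (0.31) p. 259 is UNPROVED IN PRINT; route R4 `BalabanUVNodes` decides only the CONDITIONAL finite-𝕋⁴
rung `BalabanLadder.UV` — not the continuum limit, not OS, NOT the Yang–Mills mass gap (Clay).  No `sorry`, no `axiom`.
-/

namespace Summit.QuantumFields.YangMills.Cruxes.EndpointGivenBR13SepCoPH.RunsGivenB5

open Filter Topology
open Literature.MathematicalPhysics.QuantumFieldTheory.Balaban1983to89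
open Literature.MathematicalPhysics.QuantumFieldTheory.Balaban1983to89.FlowStep
open Literature.MathematicalPhysics.QuantumFieldTheory.Balaban1983to89.T4Continuum (T4Family)
open Literature.MathematicalPhysics.QuantumFieldTheory.Balaban1983to89.B12Beta (HistBox)
open Summit.QuantumFields.YangMills.Theorems.BalabanUVNodesK2NamedJetsRunRemAt (RunConstRemainder)

noncomputable section

/-! ## §1  Which coupling slots the printed recursion reads (kernel congruence) -/

section Slots

open B12Eq019ActionBody

variable {P : Params} {G : Type*} [GaugeGroup G]

/-- `A_k` of the recursion `A_{j+1} = 𝐓_j A_j` (0.19) reads the coupling sequence only BELOW `k`: two sequences agreeing on `j < k` give the same `A_k`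
(structural induction on (0.19); [Balaban1987RG1] (0.19) p. 255 «the sequence of actions … is defined for k = 0, 1, …»). [cite: Balaban1987RG1, (0.19) p.255] -/
theorem actionSeq_congr_below (Tk : ∀ k, Density P k G → Density P (k + 1) G) (χ GF : ∀ k, Density P k G) {g g' : ℕ → ℝ}
    (A₀ : Density P 0 G) : ∀ k : ℕ, (∀ i, i < k → g i = g' i) → actionSeq Tk χ GF g A₀ k = actionSeq Tk χ GF g' A₀ k
  | 0, _ => rfl
  | k + 1, h => by
    rw [actionSeq_succ, actionSeq_succ, actionSeq_congr_below Tk χ GF A₀ k (fun i hi => h i (Nat.lt_succ_of_lt hi)),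
      h k (Nat.lt_succ_self k)]

/-- The PRINTED sequence `A_0 = −(1/g_0²)A`, `A_{j+1} = 𝐓_j A_j` at scale `k` reads `g_0` (bare coupling, (0.17)) and `g_1, …, g_{k−1}`; it does NOT
read `g_k`. [cite: Balaban1987RG1, (0.17)–(0.19) p.255] -/
theorem printedSeq_congr_below (Tk : ∀ k, Density P k G → Density P (k + 1) G) (χ GF : ∀ k, Density P k G) {g g' : ℕ → ℝ} (w : ℝ)
    (k : ℕ) (h0 : g 0 = g' 0) (h : ∀ i, i < k → g i = g' i) : printedSeq Tk χ GF g w k = printedSeq Tk χ GF g' w k := by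
  unfold printedSeq
  rw [h0]
  exact actionSeq_congr_below Tk χ GF _ k h

/-- **THE SLOT `k` ENTERS STEP `k` ONLY AS THE GAUGE-FIXING COEFFICIENT.**  For two coupling sequences agreeing below `k`, the difference of the
`(k+1)`-st actions is the difference of `nextAction (T_k) (χ_k) (GF_k) (·) A_k` at the two values of the slot — `gk` being the coefficient `1/g_k²`
of `GF_k = Σ_y Σ_{x∈B(y)} [1 − Re tr U(y,x)]` in `integrand` ((0.19) p. 255), with the SAME `A_k`. [cite: Balaban1987RG1, (0.19) p.255] -/
theorem printedSeq_succ_sub_of_agree_below (Tk : ∀ k, Density P k G → Density P (k + 1) G) (χ GF : ∀ k, Density P k G) {g g' : ℕ → ℝ}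
    (w : ℝ) (k : ℕ) (h0 : g 0 = g' 0) (h : ∀ i, i < k → g i = g' i) (V : GaugeField P (k + 1) G) :
    printedSeq Tk χ GF g w (k + 1) V - printedSeq Tk χ GF g' w (k + 1) V =
      nextAction (Tk k) (χ k) (GF k) (g k) (printedSeq Tk χ GF g w k) V
        - nextAction (Tk k) (χ k) (GF k) (g' k) (printedSeq Tk χ GF g w k) V := by
  rw [printedSeq_succ, printedSeq_succ, ← printedSeq_congr_below Tk χ GF w k h0 h]

end Slots

section RecordSlots

variable {F : T4Family} {N : ℕ} [NeZero N]

/-- At the record's small-field functions (2.9) — coupling-blind by typing (`Node00.chiFixed29_flowBlind`) — the effective action `A_k` over any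
transport reads only the slots below `k` (and slot 0). [cite: Balaban1987RG1, (0.17)–(0.19) p.255 and (2.9) p.266 (bookkeeping)] -/
theorem effActionHT_congr_below (T : Node00.Transport F N) (ν : Node00.Stage7Numerics) (ε₁ : ℝ) (K : ℕ) {g g' : ℕ → ℝ} (k : ℕ)
    (h0 : g 0 = g' 0) (h : ∀ i, i < k → g i = g' i) :
    Node00.effActionHT F N T (Node00.chiFixed29 F N ν ε₁) K g k = Node00.effActionHT F N T (Node00.chiFixed29 F N ν ε₁) K g' k := by
  unfold Node00.effActionHT
  rw [Node00.chiFixed29_flowBlind ν ε₁ K g g']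
  exact printedSeq_congr_below _ _ _ 1 k h0 h

/-- **THE MERGED TERM `𝓝_{k+1}` READS SLOT `k` ONLY THROUGH THE GF COEFFICIENT OF STEP `k`** (the located typing fact of BN-F §1, as a rewrite rule at the
record's χ): for sequences agreeing below `k`, `𝓝_{k+1}(g) − 𝓝_{k+1}(g′) = 𝐓_k^{GF-coef g_k} A_k − 𝐓_k^{GF-coef g′_k} A_k` at the SAME `A_k`; the
subtracted `A_k(Ū^k U_{k+1} ·)` cancels.  Hence `β_merged k (p_0,…,p_k)`'s dependence on its LAST slot is the dependence of ONE block-spin step on the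
weight of its soft axial gauge fixing — not on the coupling of `A_k` ([Balaban1987RG1] (0.15)–(0.16), (0.19) p. 255; BN-F §1). [cite: Balaban1987RG1, (0.19) p.255 and (1.6) p.261] -/
theorem mergedTermT_sub_of_agree_below (T : Node00.Transport F N) (ν : Node00.Stage7Numerics) (ε₁ ε : ℝ) (K : ℕ) {g g' : ℕ → ℝ}
    (k : ℕ) (h0 : g 0 = g' 0) (h : ∀ i, i < k → g i = g' i) :
    ∀ W, Node00.mergedTermT F N T (Node00.chiFixed29 F N ν ε₁) ε K g k W - Node00.mergedTermT F N T (Node00.chiFixed29 F N ν ε₁) ε K g' k W =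
      B12Eq019ActionBody.nextAction (T K k) (Node00.chiFixed29 F N ν ε₁ K g k) (Node00.gfOfRecord F N K k) (g k)
          (Node00.effActionHT F N T (Node00.chiFixed29 F N ν ε₁) K g k) W
        - B12Eq019ActionBody.nextAction (T K k) (Node00.chiFixed29 F N ν ε₁ K g k) (Node00.gfOfRecord F N K k) (g' k)
          (Node00.effActionHT F N T (Node00.chiFixed29 F N ν ε₁) K g k) W := by
  intro W
  have hk : Node00.effActionHT F N T (Node00.chiFixed29 F N ν ε₁) K g' k = Node00.effActionHT F N T (Node00.chiFixed29 F N ν ε₁) K g k :=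
    (effActionHT_congr_below T ν ε₁ K k h0 h).symm
  have hs : ∀ g₁ : ℕ → ℝ, Node00.effActionHT F N T (Node00.chiFixed29 F N ν ε₁) K g₁ (k + 1) =
      B12Eq019ActionBody.nextAction (T K k) (Node00.chiFixed29 F N ν ε₁ K g₁ k) (Node00.gfOfRecord F N K k) (g₁ k)
        (Node00.effActionHT F N T (Node00.chiFixed29 F N ν ε₁) K g₁ k) := fun _ => rfl
  have hχ : Node00.chiFixed29 F N ν ε₁ K g' k = Node00.chiFixed29 F N ν ε₁ K g k := by
    rw [Node00.chiFixed29_flowBlind ν ε₁ K g' g]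
  unfold Node00.mergedTermT
  rw [hs g, hs g', hk, hχ]
  ring

end RecordSlots

/-! ## §2  What the closed end of L¹ᵤ(run) reads -/

section ClosedEnd

/-- **L¹ᵤ(run)** — VERBATIM `RunsGivenB4.RunLastVarDerivBound` (this lineage's `F3RunsGivenB4.lean`, g4; restated because Cruxes workfiles are not kept in the
built tree): along every in-window run of (0.20), `g ↦ β_{k+1}(g_0,…,g_{k−1}, g)` is differentiable WITHIN `[0, γ₀]` with `|∂β_{k+1}∕∂g_k| ≤ C`, one `C`
for all scales and runs.  HYPOTHESIS SHAPE, never a fact — and, by §1–§2 of this sheet, MIS-AIMED: its variable is the GF coefficient of step `k`. -/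
def RunLastVarDerivBound (β : HBeta) (C γ₀ : ℝ) : Prop :=
  ∀ (n : ℕ) (gs : ℕ → ℝ), RGEqH n β gs → Step.InInterval γ₀ n gs → ∀ k, k ≤ n →
    ∃ f' : ℝ → ℝ,
      (∀ g ∈ Set.Icc (0 : ℝ) γ₀,
        HasDerivWithinAt (fun g : ℝ => β k (Function.update (prefixOf gs k) (Fin.last k) g)) (f' g)
          (Set.Icc (0 : ℝ) γ₀) g) ∧
      ∀ g ∈ Set.Icc (0 : ℝ) γ₀, |f' g| ≤ C

/-- Differentiability WITHIN `[0, γ₀]` at `0` (the closed end of `RunLastVarDerivBound`) forces, along every in-window run, the RIGHT-LIMIT of the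
GF-slot section `t ↦ β_{k+1}(g_0,…,g_{k−1}, t)` at `0⁺` to be the letter-holder's value AT `t = 0`. [folklore] -/
theorem tendsto_gfSlot_of_runLastVarDerivBound {β : HBeta} {C γ₀ : ℝ} (h : RunLastVarDerivBound β C γ₀) {n : ℕ} {gs : ℕ → ℝ}
    (hrg : RGEqH n β gs) (hI : Step.InInterval γ₀ n gs) {k : ℕ} (hk : k ≤ n) :
    Tendsto (fun t : ℝ => β k (Function.update (prefixOf gs k) (Fin.last k) t)) (𝓝[>] 0)
      (𝓝 (β k (Function.update (prefixOf gs k) (Fin.last k) 0))) := by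
  obtain ⟨f', hf', -⟩ := h n gs hrg hI k hk
  have hγ₀ : 0 < γ₀ := (hI k hk).1.trans_le (hI k hk).2
  have hc : ContinuousWithinAt (fun t : ℝ => β k (Function.update (prefixOf gs k) (Fin.last k) t)) (Set.Icc (0 : ℝ) γ₀) 0 :=
    (hf' 0 ⟨le_rfl, hγ₀.le⟩).continuousWithinAt
  have hmem : Set.Icc (0 : ℝ) γ₀ ∈ 𝓝[>] (0 : ℝ) := mem_of_superset (Ioc_mem_nhdsGT hγ₀) Set.Ioc_subset_Icc_self
  have hc' : ContinuousWithinAt (fun t : ℝ => β k (Function.update (prefixOf gs k) (Fin.last k) t)) (Set.Ioi (0 : ℝ)) 0 :=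
    hc.mono_of_mem_nhdsWithin hmem
  simpa using hc'.tendsto

/-- The record-shaped β (`Node00.betaOfMerged βm β0 γ` = `β_merged` ON the box `]0,γ]^{k+1}`, the number `β0 k` OFF it): any history with a ZERO last slot
is off the box, so the value there is `β0 k` — the SAME as at the zero history. [cite: Balaban1987RG1, (2.12)–(2.14) p.268 (bookkeeping)] -/
theorem betaOfMerged_lastSlot_zero (βm : HBeta) (β0 : ℕ → ℝ) (γ : ℝ) (k : ℕ) (q : Fin (k + 1) → ℝ) :
    Node00.betaOfMerged βm β0 γ k (Function.update q (Fin.last k) 0) = β0 k :=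
  Node00.betaOfMerged_of_notMem βm β0 γ fun hmem => by simpa using (mem_box.mp hmem (Fin.last k)).1

/-- … and the zero history is off the box too. [cite: Balaban1987RG1, (2.12)–(2.14) p.268 (bookkeeping)] -/
theorem betaOfMerged_zeroHistory (βm : HBeta) (β0 : ℕ → ℝ) (γ : ℝ) (k : ℕ) :
    Node00.betaOfMerged βm β0 γ k (fun _ => 0) = β0 k :=
  Node00.betaOfMerged_of_notMem βm β0 γ fun hmem => by simpa using (mem_box.mp hmem (Fin.last k)).1

/-- **RIGIDITY BUILT INTO THE CLOSED END.**  If the record-shaped β `betaOfMerged βm β0 γ` carries L¹ᵤ(run) on a window `γ₀ ≤ γ`, then along EVERY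
in-window run — i.e. from EVERY bare coupling `g_0 = gs 0` the window admits — the GF-slot right-limit of the MERGED β at scale `k` equals the base
number `β0 k` (at the record: `beta0OfMerged βm θ.v₀ k`, the sharp-gauge β of the flow from the BASE's bare coupling, BN-F (N1)).  This is BN-F (N2)'s
rigidity («the sharp-gauge β_{k+1} is independent of the bare coupling — print never states it») carried by a DERIVATIVE letter. [cite: Balaban1987RG1, Thm 3 p.264 and (2.13) p.268] -/
theorem tendsto_gfSlot_merged_of_runLastVarDerivBound {βm : HBeta} {β0 : ℕ → ℝ} {γ C γ₀ : ℝ} (hγ : γ₀ ≤ γ)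
    (h : RunLastVarDerivBound (Node00.betaOfMerged βm β0 γ) C γ₀) {n : ℕ} {gs : ℕ → ℝ}
    (hrg : RGEqH n (Node00.betaOfMerged βm β0 γ) gs) (hI : Step.InInterval γ₀ n gs) {k : ℕ} (hk : k ≤ n) :
    Tendsto (fun t : ℝ => βm k (Function.update (prefixOf gs k) (Fin.last k) t)) (𝓝[>] 0) (𝓝 (β0 k)) := by
  have hγ₀ : 0 < γ₀ := (hI k hk).1.trans_le (hI k hk).2
  have h1 := tendsto_gfSlot_of_runLastVarDerivBound h hrg hI hk
  rw [betaOfMerged_lastSlot_zero] at h1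
  refine h1.congr' ?_
  filter_upwards [Ioc_mem_nhdsGT hγ₀] with t ht
  refine Node00.betaOfMerged_of_mem βm β0 γ (mem_box.mpr fun i => ?_)
  by_cases hi : i = Fin.last k
  · subst hi; simpa using ⟨ht.1, ht.2.trans hγ⟩
  · rw [Function.update_of_ne hi, prefixOf_apply]
    have hin : ((i : ℕ)) ≤ n := (Nat.lt_succ_iff.mp i.isLt).trans hk
    exact ⟨(hI i hin).1, (hI i hin).2.trans hγ⟩

/-- A run of one record-shaped β in a window `γ₀ ≤ γ` is a run of any other sharing its MERGED β: (0.20) reads β only at in-window prefixes, which lie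
on the box. [cite: Balaban1987RG1, (0.20) p.256 (bookkeeping)] -/
theorem rgEqH_of_sameMerged {βm : HBeta} {β0 β0' : ℕ → ℝ} {γ γ₀ : ℝ} (hγ : γ₀ ≤ γ) {n : ℕ} {gs : ℕ → ℝ}
    (hrg : RGEqH n (Node00.betaOfMerged βm β0 γ) gs) (hI : Step.InInterval γ₀ n gs) :
    RGEqH n (Node00.betaOfMerged βm β0' γ) gs := by
  intro j hj
  have hmem : prefixOf gs j ∈ Box γ j := mem_box.mpr fun i => by
    have hin : ((i : ℕ)) ≤ n := (Nat.lt_succ_iff.mp i.isLt).trans hj.le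
    simpa using ⟨(hI i hin).1, (hI i hin).2.trans hγ⟩
  rw [Node00.betaOfMerged_of_mem βm β0' γ hmem, ← Node00.betaOfMerged_of_mem βm β0 γ hmem]
  exact hrg j hj

/-- **`RunLastVarDerivBound` IS FALSE WITHOUT «ONE BASE CONVENTION»** (the `_false_without_` shape of `Negative/Anchor13FalseOfTwoBaseHistories`):
two record-shaped β's with the SAME merged β and window `γ` but base numbers differing at some scale `k` (two base histories `v₀`, BN-F (N1)) cannot BOTH
carry L¹ᵤ(run) on a window `γ₀ ≤ γ` that admits one run of length `≥ k` — the GF-slot section of the merged β would have two right-limits at `0⁺`.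
So the letter's closed end decides the base-history ambiguity by FIAT; no weak-coupling supplier can discharge it. [cite: Balaban1987RG1, Thm 3 p.264 and (2.13) p.268] -/
theorem runLastVarDerivBound_false_of_twoBases {βm : HBeta} {β0 β0' : ℕ → ℝ} {γ C C' γ₀ : ℝ} (hγ : γ₀ ≤ γ)
    (h : RunLastVarDerivBound (Node00.betaOfMerged βm β0 γ) C γ₀) (h' : RunLastVarDerivBound (Node00.betaOfMerged βm β0' γ) C' γ₀)
    {n : ℕ} {gs : ℕ → ℝ} (hrg : RGEqH n (Node00.betaOfMerged βm β0 γ) gs) (hI : Step.InInterval γ₀ n gs) {k : ℕ} (hk : k ≤ n)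
    (hne : β0 k ≠ β0' k) : False :=
  hne (tendsto_nhds_unique (tendsto_gfSlot_merged_of_runLastVarDerivBound hγ h hrg hI hk)
    (tendsto_gfSlot_merged_of_runLastVarDerivBound hγ h' (rgEqH_of_sameMerged hγ hrg hI) hI hk))

variable {F : T4Family}

/-- AT THE RECORD: the datum's β at ANY history with a zero last slot is its value at the ZERO HISTORY `fun _ => 0` (both off the box `]0, θ.γ]^{k+1}`;
`Node00.βfun_datumOfRecord₁₃SepCoPH_eq_betaOfRecord₈Tχ`, `Node00.betaOfRecord₈Tχ` = `betaOfMerged βm (beta0OfMerged βm θ.v₀) θ.γ`).  So the closed end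
of L¹ᵤ(run) at the record, and F3's (E) `EndpointId`, READ THE ZERO HISTORY — the number CRIT-2's two-base-histories witnesses move
(`Negative/Anchor13FalseOfTwoBaseHistories`: tuples agreeing on every `HistBox` and differing at `fun _ => 0`). [cite: Balaban1987RG1, (2.12)–(2.14) p.268 (bookkeeping)] -/
theorem βfun_lastSlot_zero_eq_zeroHistory (θ : Node00.Stage13HParams F 2) (hP : θ.Provisos₁₃SepCoPH F 2) (k : ℕ) (q : Fin (k + 1) → ℝ) :
    (Node00.datumOfRecord₁₃SepCoPH F 2 θ hP).βfun k (Function.update q (Fin.last k) 0) =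
      (Node00.datumOfRecord₁₃SepCoPH F 2 θ hP).βfun k (fun _ => 0) := by
  rw [Node00.βfun_datumOfRecord₁₃SepCoPH_eq_betaOfRecord₈Tχ, Node00.betaOfRecord₈Tχ, betaOfMerged_lastSlot_zero, betaOfMerged_zeroHistory]

/-- **THE CLOSED END AT THE RECORD, DISPLAYED**: if the datum's β carries L¹ᵤ(run) on some window, then along every in-window run of the datum's own
flow the GF-slot section `t ↦ β_{k+1}(g_0,…,g_{k−1},t)` of the datum's β tends, as `t → 0⁺`, to the datum's value at the ZERO HISTORY — for every bare
coupling `g_0` the window admits (BN-F (N2) rigidity; at the tree's inhabited tuples `v₀ = 0` that value is the β of the zero-action flow, BN-F (N1)). [cite: Balaban1987RG1, Thm 3 p.264 and (2.13) p.268] -/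
theorem tendsto_gfSlot_zeroHistory_of_runLastVarDerivBound (θ : Node00.Stage13HParams F 2) (hP : θ.Provisos₁₃SepCoPH F 2) {C γ₀ : ℝ}
    (h : RunLastVarDerivBound (Node00.datumOfRecord₁₃SepCoPH F 2 θ hP).βfun C γ₀) {n : ℕ} {gs : ℕ → ℝ}
    (hrg : RGEqH n (Node00.datumOfRecord₁₃SepCoPH F 2 θ hP).βfun gs) (hI : Step.InInterval γ₀ n gs) {k : ℕ} (hk : k ≤ n) :
    Tendsto (fun t : ℝ => (Node00.datumOfRecord₁₃SepCoPH F 2 θ hP).βfun k (Function.update (prefixOf gs k) (Fin.last k) t)) (𝓝[>] 0)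
      (𝓝 ((Node00.datumOfRecord₁₃SepCoPH F 2 θ hP).βfun k (fun _ => 0))) := by
  rw [← βfun_lastSlot_zero_eq_zeroHistory θ hP k (prefixOf gs k)]
  exact tendsto_gfSlot_of_runLastVarDerivBound h hrg hI hk

end ClosedEnd

/-! ## §3  The redirect (no new letter)

The honest run-format residual of `stub_runRemNamedJets13`'s `RunConstRemainder` conjunct is a MODULUS ∕ RATE IN THE RUNNING COUPLING read AT the
in-window run prefixes — never off the run, hence never in the GF slot: idea-5 ed. 2.3's `Idea5Ed23.RunModRemainder β b ω γ₀`
(`ConvexFibreWittenSketch3.lean` :79, indexation `k ≤ n` = DEF-1's; `runModRemainder_const_iff` :83 = `Iff.rfl` with the tree letter at constant ω;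
`runConstRemainder_of_runModRemainder` :90: `ω → 0` at `0⁺` ⟹ `RunConstRemainder β b r γ₁` on a sub-level for EVERY `r > 0`, so the cap `s ≤ θ.cβ·stepBal 2 F.L`
is met with `le_rfl`; CRIT-2 ROUND 3 priced it) and its `j < n` sibling `Idea5GaugeSlot.ModOnRuns` (ed. 2.2).  Print's rate along runs is `ω(t) = C·t²`
([Balaban1987RG1] Thm 3 p. 264: β_{k+1}(g_k) = one-loop + O(g_k²) along `0 < g_k ≤ γ`; [Balaban1988RG2] p. 8).  This sheet files NO competing name:
card `runs-given-b` EDITION 5 names `RunModRemainder` (idea-5, credited) as the supplier-side residual it shares, and keeps as its own content only the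
consumer-side re-cut (the registered 2ᴮ″ text) and the (D1) anchoring. -/


end

end Summit.QuantumFields.YangMills.Cruxes.EndpointGivenBR13SepCoPH.RunsGivenB5
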